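import Summits.QuantumFields.QCD.Theorems.HeatSlicedQuarksSmallFieldUltracontractivityFixedPointA

/-!
# Caloric fixed point — part D2: the row of the Duhamel integrand
(helpers of the line lead for `stub_caloricFixedPoint`, crux `SmallFieldUltracontractivity`,
item stmt-QuantumFields-8871, line `point-centred-axial-parabolic`)

Finite-dimensional bookkeeping for the four terms of the cut-off Duhamel integrand
`F = K · (θ (H₁M − MH) + θ' M) · P`, `H = DᴴD`, `H₁ = D₁ᴴD₁`, `E = D − D₁`:

* `conjTranspose_mul_self_sub` — `H − H₁ = D₁ᴴE + EᴴD`, hence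
  `H₁M − MH = [H₁, M] − M D₁ᴴ E − M Eᴴ D` (`comm_sub_eq`);
* `sqrt_rowSq_smul_mul_heat_le` — `‖row_i(K (c•X) e^{-τAᴴA})‖₂ ≤ c ‖row_i(K X)‖₂` (contraction of the
  heat semigroup on rows, taken as a hypothesis in the registered form of `stub_heatRowCalculus` (1));
* `rowSq_mul_diagonal_le` — a diagonal cutoff with entries of modulus `≤ 1` does not increase rows;
* `sqrt_rowSq_mul_mul_le_of_support` — `‖row_i(X (Y W))‖₂ ≤ (Σ_k |X_{ik}|) · Λ · Z` when the rows of
  `|Y|` met by the row of `X` sum to `≤ Λ` and the rows of `W` met by those rows of `Y` are `≤ Z` in `ℓ²`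
  (the shape of both perturbative terms `T2a = (K M D₁ᴴ)(E P)` and `T2b = (K M)(Eᴴ (D P))`);
* `sqrt_rowSq_integrand_le` — the assembled pointwise bound
  `‖row_i F‖₂ ≤ θ Q + θ S Λ Y + θ R Λ Z + θ' R₂`.

Pure Mathlib (plus part A); no named facts.
-/

noncomputable section

namespace Summit.QuantumFields.QCD.Cruxes.SmallFieldUltracontractivity.PointCentredAxialParabolic

open scoped Matrix ComplexConjugate

variable {ι : Type*} [Fintype ι] [DecidableEq ι]

/-! ### Algebra of the perturbation -/

omit [DecidableEq ι] in
/-- `DᴴD − D₁ᴴD₁ = D₁ᴴ(D − D₁) + (D − D₁)ᴴD`. -/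
theorem conjTranspose_mul_self_sub (D D₁ : Matrix ι ι ℂ) :
    Dᴴ * D - D₁ᴴ * D₁ = D₁ᴴ * (D - D₁) + (D - D₁)ᴴ * D := by
  rw [Matrix.conjTranspose_sub, Matrix.mul_sub, Matrix.sub_mul]
  abel

omit [DecidableEq ι] in
/-- `H₁M − MH = (H₁M − MH₁) − M D₁ᴴ (D − D₁) − M (D − D₁)ᴴ D` for `H = DᴴD`, `H₁ = D₁ᴴD₁`. -/
theorem comm_sub_eq (D D₁ M : Matrix ι ι ℂ) :
    D₁ᴴ * D₁ * M - M * (Dᴴ * D) =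
      (D₁ᴴ * D₁ * M - M * (D₁ᴴ * D₁)) - M * (D₁ᴴ * (D - D₁)) - M * ((D - D₁)ᴴ * D) := by
  have h : Dᴴ * D = D₁ᴴ * D₁ + (D₁ᴴ * (D - D₁) + (D - D₁)ᴴ * D) := by
    rw [← conjTranspose_mul_self_sub]; abel
  rw [h, Matrix.mul_add, Matrix.mul_add]
  abel

omit [DecidableEq ι] in
/-- The Duhamel integrand, expanded into its four terms:
`K (θ•(H₁M − MH) + θ'•M) P = K(θ•[H₁,M])P − K(θ•(M D₁ᴴE))P − K(θ•(M EᴴD))P + K(θ'•M)P`. -/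
theorem integrand_expand (K P D D₁ M : Matrix ι ι ℂ) (θ θ' : ℂ) :
    K * (θ • (D₁ᴴ * D₁ * M - M * (Dᴴ * D)) + θ' • M) * P =
      K * (θ • (D₁ᴴ * D₁ * M - M * (D₁ᴴ * D₁))) * P - K * (θ • (M * (D₁ᴴ * (D - D₁)))) * P
        - K * (θ • (M * ((D - D₁)ᴴ * D))) * P + K * (θ' • M) * P := by
  rw [comm_sub_eq, smul_sub, smul_sub]
  simp only [Matrix.mul_add, Matrix.mul_sub, Matrix.add_mul, Matrix.sub_mul]

/-! ### Rows of scaled products with a heat factor -/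

omit [DecidableEq ι] in
/-- Scaling a matrix scales the row `ℓ²` norm: `‖row_i(c • X)‖₂ = |c| ‖row_i X‖₂` (real `c ≥ 0`). -/
theorem sqrt_rowSq_smul (X : Matrix ι ι ℂ) {c : ℝ} (hc : 0 ≤ c) (i : ι) :
    Real.sqrt (∑ j, ‖((c : ℂ) • X) i j‖ ^ 2) = c * Real.sqrt (∑ j, ‖X i j‖ ^ 2) := by
  have h : ∑ j, ‖((c : ℂ) • X) i j‖ ^ 2 = c ^ 2 * ∑ j, ‖X i j‖ ^ 2 := by
    rw [Finset.mul_sum]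
    refine Finset.sum_congr rfl fun j _ => ?_
    rw [Matrix.smul_apply, smul_eq_mul, norm_mul, Complex.norm_real, Real.norm_eq_abs, abs_of_nonneg hc,
      mul_pow]
  rw [h, Real.sqrt_mul (sq_nonneg c), Real.sqrt_sq hc]

/-- **Contraction of the heat factor on rows** (from the registered form of `stub_heatRowCalculus` (1)):
`‖row_i(X e^{-τAᴴA})‖₂ ≤ ‖row_i X‖₂` for `τ ≥ 0`. -/
theorem sqrt_rowSq_mul_heat_le
    (hContr : ∀ (ι : Type) [Fintype ι] [DecidableEq ι] (A : Matrix ι ι ℂ) (w : ι → ℂ) (τ : ℝ), 0 ≤ τ →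
      ∑ j, ‖∑ i, w i * (NormedSpace.exp (-(τ : ℂ) • (Aᴴ * A))) i j‖ ^ 2 ≤ ∑ i, ‖w i‖ ^ 2)
    {κ : Type} [Fintype κ] [DecidableEq κ] (X A : Matrix κ κ ℂ) {τ : ℝ} (hτ : 0 ≤ τ) (i : κ) :
    Real.sqrt (∑ j, ‖(X * NormedSpace.exp (-(τ : ℂ) • (Aᴴ * A))) i j‖ ^ 2) ≤
      Real.sqrt (∑ j, ‖X i j‖ ^ 2) := by
  refine Real.sqrt_le_sqrt ?_
  have h := hContr κ A (X i) τ hτ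
  simpa only [Matrix.mul_apply] using h

/-- **Scaled product with a heat factor**: `‖row_i(K (c•Y) e^{-τAᴴA})‖₂ ≤ c ‖row_i(K Y)‖₂`
(`c ≥ 0`, `τ ≥ 0`). -/
theorem sqrt_rowSq_smul_mul_heat_le
    (hContr : ∀ (ι : Type) [Fintype ι] [DecidableEq ι] (A : Matrix ι ι ℂ) (w : ι → ℂ) (τ : ℝ), 0 ≤ τ →
      ∑ j, ‖∑ i, w i * (NormedSpace.exp (-(τ : ℂ) • (Aᴴ * A))) i j‖ ^ 2 ≤ ∑ i, ‖w i‖ ^ 2)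
    {κ : Type} [Fintype κ] [DecidableEq κ] (K Y A : Matrix κ κ ℂ) {c τ : ℝ} (hc : 0 ≤ c) (hτ : 0 ≤ τ)
    (i : κ) :
    Real.sqrt (∑ j, ‖(K * ((c : ℂ) • Y) * NormedSpace.exp (-(τ : ℂ) • (Aᴴ * A))) i j‖ ^ 2) ≤
      c * Real.sqrt (∑ j, ‖(K * Y) i j‖ ^ 2) := by
  rw [Matrix.mul_smul, Matrix.smul_mul, sqrt_rowSq_smul _ hc]
  exact mul_le_mul_of_nonneg_left (sqrt_rowSq_mul_heat_le hContr (K * Y) A hτ i) hc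

/-- **A bounded diagonal factor does not increase rows**: if `‖d j‖ ≤ 1` for all `j` then
`Σ_j ‖(X · diagonal d) i j‖² ≤ Σ_j ‖X i j‖²`. -/
theorem rowSq_mul_diagonal_le (X : Matrix ι ι ℂ) (d : ι → ℂ) (hd : ∀ j, ‖d j‖ ≤ 1) (i : ι) :
    ∑ j, ‖(X * Matrix.diagonal d) i j‖ ^ 2 ≤ ∑ j, ‖X i j‖ ^ 2 := by
  refine Finset.sum_le_sum fun j _ => ?_
  rw [Matrix.mul_diagonal, norm_mul]
  have h0 : 0 ≤ ‖X i j‖ := norm_nonneg _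
  calc (‖X i j‖ * ‖d j‖) ^ 2 ≤ (‖X i j‖ * 1) ^ 2 := by
        gcongr
        exact hd j
    _ = ‖X i j‖ ^ 2 := by rw [mul_one]

/-! ### Rows of triple products with support control -/

/-- **Rows of `X (Y W)` with support control.**  If every index `k` met by the row of `X` (`X_{ik} ≠ 0`)
has `Σ_{k'} |Y_{kk'}| ≤ Λ` and, along that row of `Y`, every `k'` with `Y_{kk'} ≠ 0` has
`‖row_{k'} W‖₂ ≤ Z` (`Z ≥ 0`), then `‖row_i(X (Y W))‖₂ ≤ (Σ_k |X_{ik}|) Λ Z`. -/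
theorem sqrt_rowSq_mul_mul_le_of_support {κ : Type*} [Fintype κ] (X Y W : Matrix κ κ ℂ) (i : κ)
    {Λ Z : ℝ} (hZ : 0 ≤ Z)
    (hY : ∀ k, X i k ≠ 0 → ∑ k', ‖Y k k'‖ ≤ Λ)
    (hW : ∀ k k', X i k ≠ 0 → Y k k' ≠ 0 → Real.sqrt (∑ j, ‖W k' j‖ ^ 2) ≤ Z) :
    Real.sqrt (∑ j, ‖(X * (Y * W)) i j‖ ^ 2) ≤ (∑ k, ‖X i k‖) * Λ * Z := by
  refine (sqrt_rowSq_mul_le X (Y * W) i).trans ?_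
  rw [Finset.sum_mul, Finset.sum_mul]
  refine Finset.sum_le_sum fun k _ => ?_
  by_cases hk : X i k = 0
  · simp [hk]
  · rw [mul_assoc]
    refine mul_le_mul_of_nonneg_left ?_ (norm_nonneg _)
    refine (sqrt_rowSq_mul_le Y W k).trans ?_
    calc ∑ k', ‖Y k k'‖ * Real.sqrt (∑ j, ‖W k' j‖ ^ 2) ≤ ∑ k', ‖Y k k'‖ * Z := by
          refine Finset.sum_le_sum fun k' _ => ?_
          by_cases hk' : Y k k' = 0
          · simp [hk']
          · exact mul_le_mul_of_nonneg_left (hW k k' hk hk') (norm_nonneg _)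
      _ = (∑ k', ‖Y k k'‖) * Z := by rw [Finset.sum_mul]
      _ ≤ Λ * Z := mul_le_mul_of_nonneg_right (hY k hk) hZ

/-! ### The four-term triangle inequality -/

omit [DecidableEq ι] in
/-- `‖row_i(A − B − C + D)‖₂ ≤ ‖row_i A‖₂ + ‖row_i B‖₂ + ‖row_i C‖₂ + ‖row_i D‖₂`. -/
theorem sqrt_rowSq_sub_sub_add_le (A B C D : Matrix ι ι ℂ) (i : ι) :
    Real.sqrt (∑ j, ‖(A - B - C + D) i j‖ ^ 2) ≤
      Real.sqrt (∑ j, ‖A i j‖ ^ 2) + Real.sqrt (∑ j, ‖B i j‖ ^ 2) + Real.sqrt (∑ j, ‖C i j‖ ^ 2) +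
        Real.sqrt (∑ j, ‖D i j‖ ^ 2) := by
  have h1 := sqrt_sum_norm_sq_add_le (fun j => (A - B - C) i j) (fun j => D i j)
  have h2 := sqrt_sum_norm_sq_add_le (fun j => (A - B) i j) (fun j => (-C) i j)
  have h3 := sqrt_sum_norm_sq_add_le (fun j => A i j) (fun j => (-B) i j)
  simp only [Matrix.sub_apply, Matrix.neg_apply, ← sub_eq_add_neg, norm_neg] at h1 h2 h3
  simp only [Matrix.add_apply, Matrix.sub_apply]
  linarith

/-! ### The assembled pointwise bound on the integrand row -/

/-- **Row of the cut-off Duhamel integrand.**  With `H = DᴴD`, `H₁ = D₁ᴴD₁`, `E = D − D₁`, a diagonal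
cutoff `M = diagonal d` (`|d| ≤ 1`), `P = e^{-τH}` (`τ ≥ 0`), weights `θ, θ' ≥ 0` and any `K`:
if `‖row_i K‖₂ ≤ R₂`, `‖row_i(K [H₁,M])‖₂ ≤ Q`, `Σ_k |(K M D₁ᴴ)_{ik}| ≤ S`, `Σ_k |(K M)_{ik}| ≤ R`, the rows
of `|E|` (resp. `|Eᴴ|`) met by the row of `K M D₁ᴴ` (resp. `K M`) sum to `≤ Λ`, and the rows of `P`
(resp. `D P`) met through them are `≤ Y` (resp. `≤ Z`) in `ℓ²`, then
`‖row_i(K (θ(H₁M − MH) + θ'M) P)‖₂ ≤ θ Q + θ S Λ Y + θ R Λ Z + θ' R₂`. -/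
theorem sqrt_rowSq_integrand_le
    (hContr : ∀ (ι : Type) [Fintype ι] [DecidableEq ι] (A : Matrix ι ι ℂ) (w : ι → ℂ) (τ : ℝ), 0 ≤ τ →
      ∑ j, ‖∑ i, w i * (NormedSpace.exp (-(τ : ℂ) • (Aᴴ * A))) i j‖ ^ 2 ≤ ∑ i, ‖w i‖ ^ 2)
    {κ : Type} [Fintype κ] [DecidableEq κ] (K D D₁ : Matrix κ κ ℂ) (d : κ → ℂ) (hd : ∀ j, ‖d j‖ ≤ 1)
    {τ θ θ' : ℝ} (hτ : 0 ≤ τ) (hθ : 0 ≤ θ) (hθ' : 0 ≤ θ') (i : κ)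
    {R₂ Q S R Λ Y Z : ℝ} (hΛ : 0 ≤ Λ) (hY : 0 ≤ Y) (hZ : 0 ≤ Z)
    (h1 : Real.sqrt (∑ j, ‖K i j‖ ^ 2) ≤ R₂)
    (h3 : Real.sqrt (∑ j, ‖(K * (D₁ᴴ * D₁ * Matrix.diagonal d - Matrix.diagonal d * (D₁ᴴ * D₁))) i j‖ ^ 2) ≤ Q)
    (hS : ∑ k, ‖(K * Matrix.diagonal d * D₁ᴴ) i k‖ ≤ S)
    (hR : ∑ k, ‖(K * Matrix.diagonal d) i k‖ ≤ R)
    (hE : ∀ k, (K * Matrix.diagonal d * D₁ᴴ) i k ≠ 0 → ∑ k', ‖(D - D₁) k k'‖ ≤ Λ)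
    (hP : ∀ k k', (K * Matrix.diagonal d * D₁ᴴ) i k ≠ 0 → (D - D₁) k k' ≠ 0 →
      Real.sqrt (∑ j, ‖(NormedSpace.exp (-(τ : ℂ) • (Dᴴ * D))) k' j‖ ^ 2) ≤ Y)
    (hEH : ∀ k, (K * Matrix.diagonal d) i k ≠ 0 → ∑ k', ‖(D - D₁)ᴴ k k'‖ ≤ Λ)
    (hDP : ∀ k k', (K * Matrix.diagonal d) i k ≠ 0 → (D - D₁)ᴴ k k' ≠ 0 →
      Real.sqrt (∑ j, ‖(D * NormedSpace.exp (-(τ : ℂ) • (Dᴴ * D))) k' j‖ ^ 2) ≤ Z) :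
    Real.sqrt (∑ j, ‖(K * (((θ : ℂ)) • (D₁ᴴ * D₁ * Matrix.diagonal d - Matrix.diagonal d * (Dᴴ * D)) +
        ((θ' : ℂ)) • Matrix.diagonal d) * NormedSpace.exp (-(τ : ℂ) • (Dᴴ * D))) i j‖ ^ 2) ≤
      θ * Q + θ * S * Λ * Y + θ * R * Λ * Z + θ' * R₂ := by
  set P := NormedSpace.exp (-(τ : ℂ) • (Dᴴ * D)) with hP_def
  set M := Matrix.diagonal d with hM
  rw [integrand_expand K P D D₁ M (θ : ℂ) (θ' : ℂ)]
  refine (sqrt_rowSq_sub_sub_add_le _ _ _ _ i).trans ?_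
  have hS0 : 0 ≤ S := le_trans (Finset.sum_nonneg fun _ _ => norm_nonneg _) hS
  have hR0 : 0 ≤ R := le_trans (Finset.sum_nonneg fun _ _ => norm_nonneg _) hR
  -- T3: the commutator term
  have t3 : Real.sqrt (∑ j, ‖(K * ((θ : ℂ) • (D₁ᴴ * D₁ * M - M * (D₁ᴴ * D₁))) * P) i j‖ ^ 2) ≤ θ * Q := by
    refine (sqrt_rowSq_smul_mul_heat_le hContr K _ D hθ hτ i).trans ?_
    exact mul_le_mul_of_nonneg_left h3 hθ
  -- T2a: `K (θ•(M D₁ᴴ E)) P = θ • ((K M D₁ᴴ) (E P))`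
  have t2a : Real.sqrt (∑ j, ‖(K * ((θ : ℂ) • (M * (D₁ᴴ * (D - D₁)))) * P) i j‖ ^ 2) ≤ θ * S * Λ * Y := by
    have hrew : K * ((θ : ℂ) • (M * (D₁ᴴ * (D - D₁)))) * P =
        (θ : ℂ) • ((K * M * D₁ᴴ) * ((D - D₁) * P)) := by
      rw [Matrix.mul_smul, Matrix.smul_mul]
      congr 1
      simp only [Matrix.mul_assoc]
    rw [hrew, sqrt_rowSq_smul _ hθ, show θ * S * Λ * Y = θ * (S * Λ * Y) by ring]
    refine mul_le_mul_of_nonneg_left ?_ hθ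
    refine (sqrt_rowSq_mul_mul_le_of_support (K * M * D₁ᴴ) (D - D₁) P i hY hE hP).trans ?_
    exact mul_le_mul_of_nonneg_right (mul_le_mul_of_nonneg_right hS hΛ) hY
  -- T2b: `K (θ•(M Eᴴ D)) P = θ • ((K M) (Eᴴ (D P)))`
  have t2b : Real.sqrt (∑ j, ‖(K * ((θ : ℂ) • (M * ((D - D₁)ᴴ * D))) * P) i j‖ ^ 2) ≤ θ * R * Λ * Z := by
    have hrew : K * ((θ : ℂ) • (M * ((D - D₁)ᴴ * D))) * P =
        (θ : ℂ) • ((K * M) * ((D - D₁)ᴴ * (D * P))) := by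
      rw [Matrix.mul_smul, Matrix.smul_mul]
      congr 1
      simp only [Matrix.mul_assoc]
    rw [hrew, sqrt_rowSq_smul _ hθ, show θ * R * Λ * Z = θ * (R * Λ * Z) by ring]
    refine mul_le_mul_of_nonneg_left ?_ hθ
    refine (sqrt_rowSq_mul_mul_le_of_support (K * M) (D - D₁)ᴴ (D * P) i hZ hEH hDP).trans ?_
    exact mul_le_mul_of_nonneg_right (mul_le_mul_of_nonneg_right hR hΛ) hZ
  -- T1: the free term
  have t1 : Real.sqrt (∑ j, ‖(K * ((θ' : ℂ) • M) * P) i j‖ ^ 2) ≤ θ' * R₂ := by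
    refine (sqrt_rowSq_smul_mul_heat_le hContr K M D hθ' hτ i).trans ?_
    refine mul_le_mul_of_nonneg_left ?_ hθ'
    exact (Real.sqrt_le_sqrt (rowSq_mul_diagonal_le K d hd i)).trans h1
  linarith

/-- **Registered form (stub `stub_integrandRow` of the crux item)**: the assembled pointwise bound on the
row of the cut-off Duhamel integrand (`sqrt_rowSq_integrand_le` at `κ : Type`). -/
theorem stub_integrandRow :
    ∀ (κ : Type) [Fintype κ] [DecidableEq κ],
      (∀ (ι : Type) [Fintype ι] [DecidableEq ι] (A : Matrix ι ι ℂ) (w : ι → ℂ) (τ : ℝ), 0 ≤ τ →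
        ∑ j, ‖∑ i, w i * (NormedSpace.exp (-(τ : ℂ) • (Aᴴ * A))) i j‖ ^ 2 ≤ ∑ i, ‖w i‖ ^ 2) →
      ∀ (K D D₁ : Matrix κ κ ℂ) (d : κ → ℂ), (∀ j, ‖d j‖ ≤ 1) →
      ∀ (τ θ θ' : ℝ), 0 ≤ τ → 0 ≤ θ → 0 ≤ θ' → ∀ (i : κ) (R₂ Q S R Λ Y Z : ℝ), 0 ≤ Λ → 0 ≤ Y → 0 ≤ Z →
      Real.sqrt (∑ j, ‖K i j‖ ^ 2) ≤ R₂ →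
      Real.sqrt (∑ j, ‖(K * (D₁ᴴ * D₁ * Matrix.diagonal d - Matrix.diagonal d * (D₁ᴴ * D₁))) i j‖ ^ 2) ≤ Q →
      ∑ k, ‖(K * Matrix.diagonal d * D₁ᴴ) i k‖ ≤ S →
      ∑ k, ‖(K * Matrix.diagonal d) i k‖ ≤ R →
      (∀ k, (K * Matrix.diagonal d * D₁ᴴ) i k ≠ 0 → ∑ k', ‖(D - D₁) k k'‖ ≤ Λ) →
      (∀ k k', (K * Matrix.diagonal d * D₁ᴴ) i k ≠ 0 → (D - D₁) k k' ≠ 0 →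
        Real.sqrt (∑ j, ‖(NormedSpace.exp (-(τ : ℂ) • (Dᴴ * D))) k' j‖ ^ 2) ≤ Y) →
      (∀ k, (K * Matrix.diagonal d) i k ≠ 0 → ∑ k', ‖(D - D₁)ᴴ k k'‖ ≤ Λ) →
      (∀ k k', (K * Matrix.diagonal d) i k ≠ 0 → (D - D₁)ᴴ k k' ≠ 0 →
        Real.sqrt (∑ j, ‖(D * NormedSpace.exp (-(τ : ℂ) • (Dᴴ * D))) k' j‖ ^ 2) ≤ Z) →
      Real.sqrt (∑ j, ‖(K * (((θ : ℂ)) • (D₁ᴴ * D₁ * Matrix.diagonal d - Matrix.diagonal d * (Dᴴ * D)) +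
          ((θ' : ℂ)) • Matrix.diagonal d) * NormedSpace.exp (-(τ : ℂ) • (Dᴴ * D))) i j‖ ^ 2) ≤
        θ * Q + θ * S * Λ * Y + θ * R * Λ * Z + θ' * R₂ :=
  fun _ _ _ hContr K D D₁ d hd _ _ _ hτ hθ hθ' i _ _ _ _ _ _ _ hΛ hY hZ h1 h3 hS hR hE hP hEH hDP =>
    sqrt_rowSq_integrand_le hContr K D D₁ d hd hτ hθ hθ' i hΛ hY hZ h1 h3 hS hR hE hP hEH hDP

end Summit.QuantumFields.QCD.Cruxes.SmallFieldUltracontractivity.PointCentredAxialParabolic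

end
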